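import Literature.NumberTheory.Automorphic.QuaternionLocalRamified
import Literature.NumberTheory.Automorphic.BrandtModuleResidue
import HarnessLib

/-!
# Structure of the maximal order at a ramified prime: uniformiser, the ideals `π^k O₍ₚ₎`,
# the unit count `|O₍ₚ₎ˣ mod p| = p⁴ - p²` and the norm-level complement `π^R O₍ₚ₎`

Topic `NumberTheory/Automorphic`; theorems only (no definition, no named fact, no instance).
Consequences of the norm-valuation description `O₍ₚ₎ = {x | nrd x ∈ ℤ₍ₚ₎}` of the maximal
order at a ramified prime `p` of a definite quaternion algebra `B` over `ℚ`
(`QuaternionLocalRamified.lean`; Vignéras, LNM 800, Ch. II §1 Lemme 1.4), taken here as the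
*hypothesis* `hΛ : ∀ x, x ∈ O₍ₚ₎ ↔ nrd x ∈ ℤ₍ₚ₎` on a `ℤ`-order `O` (so that the results apply
verbatim to an Eichler order, which agrees with the maximal orders at the ramified primes):

* `exists_uniformizer_of_ramified` — a **uniformiser** `π ∈ O₍ₚ₎` with `v_p(nrd π) = 1`
  (Vignéras II §1: `P = O π`, `n(π)` engendre `p`; existence from the isotropy of `nrd` modulo
  `p`, the tree's `IsZOrder.exists_nrdZ_dvd_not_mem`, and `hΛ`);
* `mem_units_smul_localAt_iff_of_ramified` — `x ∈ z O₍ₚ₎ ↔ x = 0 ∨ v_p(nrd z) ≤ v_p(nrd x)`: the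
  one-sided ideals are the `π^k O₍ₚ₎ = {v_p ∘ nrd ≥ k}` (II §1 after Lemme 1.4: "les idéaux ...
  sont bilatères, ce sont les `P^n = O π^n`"), of index `[O₍ₚ₎ : π^k O₍ₚ₎] = p^{2k}`
  (`relIndex_units_smul_localAt_of_ramified`);
* `coe_stabilizer_eq_diff_of_ramified`, `ncard_image_stabilizer_of_ramified` — the units of
  `O₍ₚ₎` are `O₍ₚ₎ ∖ π O₍ₚ₎`, so **`|O₍ₚ₎ˣ mod p O₍ₚ₎| = p⁴ - p²`** (`= |(O/P)ˣ| · |P/pO|`,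
  `O/P ≅ 𝔽_{p²}`, II §1 Cor. 1.7);
* `diff_iUnion_normLevelUnits_eq_of_ramified`, `ncard_image_normLevel_compl_of_ramified` — the
  complement in `O₍ₚ₎` of the norm levels `X_k`, `k < R` (`normLevelUnits`,
  `QuaternionLocalUnitDensity.lean`) is `π^R O₍ₚ₎`, with **`p^{2R}` residues modulo `p^R O₍ₚ₎`**
  — the `o(p^{4R})` input of the unit-density computation of the local Euler factor at a
  ramified prime in Eichler's mass formula (`brandtModule_massFormula`; Voight §26.4,
  Lemma 26.6.7).

## References

* M.-F. Vignéras, *Arithmétique des algèbres de quaternions*, LNM 800 (1980), Ch. II §1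
  Lemme 1.4, Cor. 1.7 [VignerasLNM800].
* J. Voight, *Quaternion Algebras*, GTM 288 (2021), Thm. 13.3.11, §26.4, Lemma 26.6.7.
-/

noncomputable section

open scoped TensorProduct Pointwise

universe u

namespace Literature.NumberTheory.Automorphic

variable {B : Type u} [Ring B] [Algebra ℚ B] [IsQuaternionAlgebra ℚ B] {p : ℕ} [hp : Fact p.Prime]

/-! ### Valuation bookkeeping -/

section Valuation

/-- A quaternion algebra is a nontrivial ring. [folklore] -/
theorem IsQuaternionAlgebra.nontrivial_rat : Nontrivial B :=
  Module.nontrivial_of_finrank_pos (R := ℚ)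
    (by rw [IsQuaternionAlgebra.finrank_eq_four (K := ℚ) (D := B)]; norm_num)

/-- `nrd (x ^ k) = (nrd x) ^ k`. [folklore] -/
theorem reducedNorm_pow (x : B) (k : ℕ) : reducedNorm ℚ B (x ^ k) = reducedNorm ℚ B x ^ k := by
  induction k with
  | zero => rw [pow_zero, pow_zero, reducedNorm_one ℚ B]
  | succ k ih => rw [pow_succ, reducedNorm_mul_holds ℚ B, ih, pow_succ]

/-- `nrd` of a unit of a division algebra is non-zero. [folklore] -/
theorem reducedNorm_units_ne_zero (hdiv : ∀ x : B, x ≠ 0 → IsUnit x) [Nontrivial B] (u : Bˣ) :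
    reducedNorm ℚ B (u : B) ≠ 0 :=
  reducedNorm_ne_zero_of_ne_zero hdiv u.ne_zero

/-- `v_p(nrd(z⁻¹ x)) = v_p(nrd x) - v_p(nrd z)` for a unit `z` and `x` of non-zero norm. [folklore] -/
theorem padicValRat_reducedNorm_units_inv_mul (hdiv : ∀ x : B, x ≠ 0 → IsUnit x) [Nontrivial B]
    (z : Bˣ) {x : B} (hx : reducedNorm ℚ B x ≠ 0) :
    padicValRat p (reducedNorm ℚ B (((z⁻¹ : Bˣ) : B) * x)) =
      padicValRat p (reducedNorm ℚ B x) - padicValRat p (reducedNorm ℚ B (z : B)) := by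
  rw [reducedNorm_mul_holds ℚ B, reducedNorm_units_inv,
    padicValRat.mul (inv_ne_zero (reducedNorm_units_ne_zero hdiv z)) hx, padicValRat.inv]
  ring

/-- `v_p(nrd(z ^ k)) = k v_p(nrd z)`. [folklore] -/
theorem padicValRat_reducedNorm_units_pow (z : Bˣ) (k : ℕ) :
    padicValRat p (reducedNorm ℚ B ((z ^ k : Bˣ) : B)) = k * padicValRat p (reducedNorm ℚ B (z : B)) := by
  rw [Units.val_pow_eq_pow_val, reducedNorm_pow, padicValRat.pow]

/-- `v_p(nrd(p^R • w)) = 2R + v_p(nrd w)` (`w` of non-zero norm). [folklore] -/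
theorem padicValRat_reducedNorm_pow_smul {w : B} (hw : reducedNorm ℚ B w ≠ 0) (R : ℕ) :
    padicValRat p (reducedNorm ℚ B (((p : ℤ) ^ R) • w)) = 2 * R + padicValRat p (reducedNorm ℚ B w) := by
  have hpp : p.Prime := hp.out
  have hcast : ((p : ℤ) ^ R) • w = ((p : ℚ) ^ R) • w := by
    rw [show ((p : ℤ) ^ R) = ((p ^ R : ℕ) : ℤ) by push_cast; ring, natCast_zsmul_eq_ratCast_smul]
    push_cast; ring_nf
  have hp0 : ((p : ℚ) ^ R) ≠ 0 := pow_ne_zero _ (Nat.cast_ne_zero.mpr hpp.ne_zero)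
  rw [hcast, reducedNorm_smul, padicValRat.mul (pow_ne_zero _ hp0) hw, ← pow_mul,
    padicValRat.pow, padicValRat.self hpp.one_lt]
  push_cast; ring

end Valuation

/-! ### The ramified local model: uniformiser and the ideals `π^k O₍ₚ₎` -/

section Ramified

variable (hdiv : ∀ x : B, x ≠ 0 → IsUnit x) {O : Submodule ℤ B} (hO : IsZOrder O)
  (hΛ : ∀ x : B, x ∈ localAt p O ↔ ¬ p ∣ (reducedNorm ℚ B x).den)
include hdiv hO hΛ

omit [IsQuaternionAlgebra ℚ B] hdiv hO in
/-- Under `hΛ`: `x` lies in `O₍ₚ₎` iff `v_p(nrd x) ≥ 0` (for `x = 0` both sides hold). [cite: VignerasLNM800, Ch. II §1 Lemme 1.4] -/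
theorem mem_localAt_iff_padicValRat_of_ramified (x : B) :
    x ∈ localAt p O ↔ 0 ≤ padicValRat p (reducedNorm ℚ B x) := by
  rw [hΛ]
  exact ⟨padicValRat_nonneg_of_not_dvd_den, not_dvd_den_of_padicValRat_nonneg⟩

omit hO in
/-- **Ideals of the ramified local order are governed by the norm valuation**:
`x ∈ z O₍ₚ₎ ↔ x = 0 ∨ v_p(nrd z) ≤ v_p(nrd x)` for a unit `z` of `B`. [cite: VignerasLNM800, Ch. II §1 Lemme 1.4] -/
theorem mem_units_smul_localAt_iff_of_ramified (z : Bˣ) (x : B) :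
    x ∈ z • localAt p O ↔ x = 0 ∨
      padicValRat p (reducedNorm ℚ B (z : B)) ≤ padicValRat p (reducedNorm ℚ B x) := by
  haveI : Nontrivial B := IsQuaternionAlgebra.nontrivial_rat
  rw [mem_units_smul_iff_mul_mem]
  by_cases hx : x = 0
  · subst hx
    simp only [mul_zero, Submodule.zero_mem, true_or]
  have hxn : reducedNorm ℚ B x ≠ 0 := reducedNorm_ne_zero_of_ne_zero hdiv hx
  have hzx : ((z⁻¹ : Bˣ) : B) * x ≠ 0 := by
    intro h
    apply hx
    have := congrArg (fun w => (z : B) * w) h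
    simpa [← mul_assoc] using this
  rw [mem_localAt_iff_padicValRat_of_ramified hΛ _,
    padicValRat_reducedNorm_units_inv_mul hdiv z hxn]
  constructor
  · intro h; right; linarith
  · rintro (h | h)
    · exact absurd h hx
    · linarith

omit [IsQuaternionAlgebra ℚ B] hdiv hO in
/-- A unit of `B` with `v_p(nrd z) ≥ 0` lies in the ramified local order. [cite: VignerasLNM800, Ch. II §1 Lemme 1.4] -/
theorem units_mem_localAt_of_ramified {z : Bˣ} (hz : 0 ≤ padicValRat p (reducedNorm ℚ B (z : B))) :
    (z : B) ∈ localAt p O :=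
  (mem_localAt_iff_padicValRat_of_ramified hΛ _).mpr hz

omit hdiv in
/-- **`[O₍ₚ₎ : z O₍ₚ₎] = p^{2k}` when `v_p(nrd z) = k`.** [cite: VignerasLNM800, Ch. II §1 Lemme 1.4 and Cor. 1.7] -/
theorem relIndex_units_smul_localAt_of_ramified (z : Bˣ) (k : ℕ)
    (hz : padicValRat p (reducedNorm ℚ B (z : B)) = k) :
    (z • localAt p O).toAddSubgroup.relIndex (localAt p O).toAddSubgroup = p ^ (2 * k) := by
  have hzΛ : (z : B) ∈ localAt p O :=
    units_mem_localAt_of_ramified hΛ (by rw [hz]; exact_mod_cast Nat.zero_le k)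
  obtain ⟨k', hk', hidx⟩ := exists_relIndex_units_smul_localAt_eq_pow hO z hzΛ
  rw [hz] at hk'
  have : k = k' := by exact_mod_cast hk'
  rw [hidx, this]

/-- **A uniformiser exists**: there is `π ∈ O₍ₚ₎` with `v_p(nrd π) = 1` (from an element
`x ∈ O ∖ p O` with `p ∣ nrd x`, the tree's Chevalley–Warning isotropy
`IsZOrder.exists_nrdZ_dvd_not_mem`: if `v_p(nrd x) ≥ 2` then `x / p ∈ O₍ₚ₎` by `hΛ`, forcing
`x ∈ p O`). [cite: VignerasLNM800, Ch. II §1 Lemme 1.4 (P = Oπ)] -/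
theorem exists_uniformizer_of_ramified :
    ∃ π : Bˣ, (π : B) ∈ localAt p O ∧ padicValRat p (reducedNorm ℚ B (π : B)) = 1 := by
  have hpp : p.Prime := hp.out
  obtain ⟨x, hxO, hxp, hdvd⟩ := hO.exists_nrdZ_dvd_not_mem hpp
  have hx0 : x ≠ 0 := by
    rintro rfl
    exact hxp (Submodule.zero_mem _)
  haveI : Nontrivial B := IsQuaternionAlgebra.nontrivial_rat
  have hnrd : reducedNorm ℚ B x = (nrdZ x : ℚ) := (hO.cast_nrdZ hxO).symm
  have hxn : reducedNorm ℚ B x ≠ 0 := reducedNorm_ne_zero_of_ne_zero hdiv hx0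
  have hZ0 : nrdZ x ≠ 0 := by
    intro h; rw [h, Int.cast_zero] at hnrd; exact hxn hnrd
  have hv1 : 1 ≤ padicValRat p (reducedNorm ℚ B x) := by
    rw [hnrd, padicValRat.of_int]
    have h := (padicValInt_dvd_iff 1 (nrdZ x)).mp (by rwa [pow_one])
    rcases h with h | h
    · exact absurd h hZ0
    · exact_mod_cast h
  have hv2 : ¬ 2 ≤ padicValRat p (reducedNorm ℚ B x) := by
    intro h2
    -- `y = x / p ∈ O₍ₚ₎`
    set y : B := ((p : ℚ)⁻¹) • x with hy
    have hp0 : (p : ℚ) ≠ 0 := Nat.cast_ne_zero.mpr hpp.ne_zero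
    have hyn : reducedNorm ℚ B y = ((p : ℚ)⁻¹) ^ 2 * reducedNorm ℚ B x := by
      rw [hy, reducedNorm_smul]
    have hyv : 0 ≤ padicValRat p (reducedNorm ℚ B y) := by
      rw [hyn, padicValRat.mul (pow_ne_zero _ (inv_ne_zero hp0)) hxn, padicValRat.pow,
        padicValRat.inv, padicValRat.self hpp.one_lt]
      push_cast; linarith
    have hy0 : y ≠ 0 := by
      rw [hy]; exact smul_ne_zero (inv_ne_zero hp0) hx0
    have hyΛ : y ∈ localAt p O := (mem_localAt_iff_padicValRat_of_ramified hΛ _).mpr hyv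
    obtain ⟨m, hm0, hm, hmy⟩ := hyΛ
    have hxy : x = (p : ℤ) • y := by
      rw [hy, natCast_zsmul_eq_ratCast_smul, smul_smul, mul_inv_cancel₀ hp0, one_smul]
    have h1 : ((m : ℕ) : ℤ) • x ∈ (p : ℤ) • O := by
      rw [hxy, smul_comm]
      exact Submodule.smul_mem_pointwise_smul _ _ _ hmy
    have h2 : ((p : ℕ) : ℤ) • x ∈ (p : ℤ) • O := Submodule.smul_mem_pointwise_smul _ _ _ hxO
    have h3 := gcd_smul_mem h1 h2
    rw [Nat.Coprime.gcd_eq_one hm, Nat.cast_one, one_smul] at h3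
    exact hxp h3
  refine ⟨(hdiv x hx0).unit, ?_, ?_⟩
  · rw [IsUnit.unit_spec]; exact le_localAt p O hxO
  · rw [IsUnit.unit_spec]
    have h1' := hv1
    push Not at hv2
    have : padicValRat p (reducedNorm ℚ B x) < 2 := hv2
    omega

omit hO in
/-- `p^R O₍ₚ₎ ⊆ z O₍ₚ₎` whenever `v_p(nrd z) ≤ R`. [cite: VignerasLNM800, Ch. II §1 Lemme 1.4] -/
theorem pow_smul_localAt_le_units_smul_of_ramified (z : Bˣ) (R : ℕ)
    (hz : padicValRat p (reducedNorm ℚ B (z : B)) ≤ R) :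
    ((p : ℤ) ^ R) • localAt p O ≤ z • localAt p O := by
  haveI : Nontrivial B := IsQuaternionAlgebra.nontrivial_rat
  intro w hw
  obtain ⟨w', hw', rfl⟩ := (Submodule.mem_smul_pointwise_iff_exists w _ _).mp hw
  rw [mem_units_smul_localAt_iff_of_ramified hdiv hΛ]
  by_cases hw0 : w' = 0
  · left; rw [hw0, smul_zero]
  right
  have hwn : reducedNorm ℚ B w' ≠ 0 := reducedNorm_ne_zero_of_ne_zero hdiv hw0
  rw [padicValRat_reducedNorm_pow_smul hwn R]
  have h0 := (mem_localAt_iff_padicValRat_of_ramified hΛ _).mp hw'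
  linarith

/-! ### Units: `O₍ₚ₎ˣ = O₍ₚ₎ ∖ π O₍ₚ₎`, `|O₍ₚ₎ˣ mod p| = p⁴ - p²` -/

/-- **The units of the ramified local order are the elements of norm valuation `0`**, i.e.
`O₍ₚ₎ˣ = O₍ₚ₎ ∖ π O₍ₚ₎` as subsets of `B` (`π` a uniformiser). [cite: VignerasLNM800, Ch. II §1 Lemme 1.4] -/
theorem coe_stabilizer_eq_diff_of_ramified (π : Bˣ) (hπ : padicValRat p (reducedNorm ℚ B (π : B)) = 1) :
    Units.val '' (MulAction.stabilizer Bˣ (localAt p O) : Set Bˣ) =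
      (localAt p O : Set B) \ ((π • localAt p O : Submodule ℤ B) : Set B) := by
  haveI : Nontrivial B := IsQuaternionAlgebra.nontrivial_rat
  ext x
  simp only [Set.mem_image, SetLike.mem_coe, Set.mem_sdiff]
  constructor
  · rintro ⟨u, hu, rfl⟩
    rw [hO.mem_stabilizer_localAt_iff] at hu
    have h1 := (mem_localAt_iff_padicValRat_of_ramified hΛ _).mp hu.1
    have h2 := (mem_localAt_iff_padicValRat_of_ramified hΛ _).mp hu.2
    rw [reducedNorm_units_inv, padicValRat.inv] at h2
    refine ⟨hu.1, fun h => ?_⟩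
    rw [mem_units_smul_localAt_iff_of_ramified hdiv hΛ, hπ] at h
    rcases h with h | h
    · exact u.ne_zero h
    · linarith
  · rintro ⟨hx, hxπ⟩
    have hx0 : x ≠ 0 := by
      rintro rfl; exact hxπ (Submodule.zero_mem _)
    have h1 := (mem_localAt_iff_padicValRat_of_ramified hΛ _).mp hx
    rw [mem_units_smul_localAt_iff_of_ramified hdiv hΛ, hπ, not_or, not_le] at hxπ
    have hv0 : padicValRat p (reducedNorm ℚ B x) = 0 := by
      have := hxπ.2; omega
    refine ⟨(hdiv x hx0).unit, ?_, IsUnit.unit_spec _⟩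
    rw [hO.mem_stabilizer_localAt_iff, IsUnit.unit_spec]
    refine ⟨hx, ?_⟩
    refine (mem_localAt_iff_padicValRat_of_ramified hΛ _).mpr ?_
    rw [reducedNorm_units_inv, IsUnit.unit_spec, padicValRat.inv, hv0, neg_zero]

omit [Algebra ℚ B] [IsQuaternionAlgebra ℚ B] hp hdiv hO hΛ in
/-- Images in a quotient `B / K` of a set difference `S ∖ T` by a `K`-saturated subset `T ⊆ S`
of `S`: `mk(S ∖ T) = mk(S) ∖ mk(T)`. [folklore] -/
theorem image_mk_diff_of_saturated (K : AddSubgroup B) {S T : Set B}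
    (hsat : ∀ x ∈ S, ∀ y ∈ T, x - y ∈ K → x ∈ T) :
    (QuotientAddGroup.mk '' (S \ T) : Set (B ⧸ K)) =
      QuotientAddGroup.mk '' S \ QuotientAddGroup.mk '' T := by
  ext q
  simp only [Set.mem_image, Set.mem_sdiff]
  constructor
  · rintro ⟨x, ⟨hxS, hxT⟩, rfl⟩
    refine ⟨⟨x, hxS, rfl⟩, ?_⟩
    rintro ⟨y, hyT, hyx⟩
    apply hxT
    refine hsat x hxS y hyT ?_
    have h := QuotientAddGroup.eq.mp hyx
    rwa [← sub_eq_neg_add] at h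
  · rintro ⟨⟨x, hxS, rfl⟩, hnot⟩
    refine ⟨x, ⟨hxS, fun hxT => hnot ⟨x, hxT, rfl⟩⟩, rfl⟩

/-- **`|O₍ₚ₎ˣ mod p O₍ₚ₎| = p⁴ - p²` at a ramified prime** (the image of the unit group of the
local maximal order in `O₍ₚ₎ / p O₍ₚ₎`: all of `O₍ₚ₎ / p O₍ₚ₎`, of order `p⁴`, except the image
of `P = π O₍ₚ₎ ⊇ p O₍ₚ₎`, of order `[P : p O₍ₚ₎] = p⁴ / p² = p²`; Vignéras II §1 Cor. 1.7:
`O/P ≅ 𝔽_{p²}`). [cite: VignerasLNM800, Ch. II §1 Lemme 1.4 and Cor. 1.7] -/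
theorem ncard_image_stabilizer_of_ramified :
    (QuotientAddGroup.mk '' (Units.val '' (MulAction.stabilizer Bˣ (localAt p O) : Set Bˣ)) :
      Set (B ⧸ (((p : ℤ) ^ 1) • localAt p O).toAddSubgroup)).ncard = p ^ 4 - p ^ 2 := by
  classical
  obtain ⟨π, -, hπ⟩ := exists_uniformizer_of_ramified hdiv hO hΛ
  haveI : Nontrivial B := IsQuaternionAlgebra.nontrivial_rat
  set K : Submodule ℤ B := ((p : ℤ) ^ 1) • localAt p O with hK
  have hKπ : K ≤ π • localAt p O :=
    pow_smul_localAt_le_units_smul_of_ramified hdiv hΛ π 1 (by rw [hπ]; exact_mod_cast le_rfl)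
  have hπΛ : π • localAt p O ≤ localAt p O := by
    intro x hx
    rw [mem_units_smul_localAt_iff_of_ramified hdiv hΛ, hπ] at hx
    rcases hx with rfl | hx
    · exact Submodule.zero_mem _
    · by_cases hx0 : x = 0
      · rw [hx0]; exact Submodule.zero_mem _
      · exact (mem_localAt_iff_padicValRat_of_ramified hΛ _).mpr (by linarith)
  rw [coe_stabilizer_eq_diff_of_ramified hdiv hO hΛ π hπ,
    image_mk_diff_of_saturated K.toAddSubgroup (fun x hx y hy hxy => ?_)]
  · have hΛcard := hO.ncard_image_mk_localAt (p := p) 1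
    have hsub : (QuotientAddGroup.mk '' ((π • localAt p O : Submodule ℤ B) : Set B) : Set (B ⧸ K.toAddSubgroup)) ⊆
        QuotientAddGroup.mk '' (localAt p O : Set B) := Set.image_mono hπΛ
    rw [Set.ncard_sdiff hsub ((hO.finite_image_mk_localAt 1).subset hsub), hΛcard]
    -- `[π O₍ₚ₎ : p O₍ₚ₎] = p²`
    have hidx : (QuotientAddGroup.mk '' ((π • localAt p O : Submodule ℤ B) : Set B) :
        Set (B ⧸ K.toAddSubgroup)).ncard = p ^ 2 := by
      rw [show ((π • localAt p O : Submodule ℤ B) : Set B) = ((π • localAt p O).toAddSubgroup : Set B) from rfl,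
        ncard_image_mk_eq_relIndex]
      have hmul := AddSubgroup.relIndex_mul_relIndex (H := K.toAddSubgroup)
        (K := (π • localAt p O).toAddSubgroup) (L := (localAt p O).toAddSubgroup)
        (Submodule.toAddSubgroup_mono hKπ) (Submodule.toAddSubgroup_mono hπΛ)
      rw [relIndex_units_smul_localAt_of_ramified hO hΛ π 1 hπ, hK,
        relIndex_pow_smul_localAt hO 1] at hmul
      have hp2 : p ^ (2 * 1) ≠ 0 := pow_ne_zero _ hp.out.ne_zero
      have : K.toAddSubgroup.relIndex (π • localAt p O).toAddSubgroup * p ^ 2 = p ^ 2 * p ^ 2 := by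
        rw [show p ^ 2 * p ^ 2 = p ^ (4 * 1) by ring, ← hmul]
      exact Nat.eq_of_mul_eq_mul_right (pos_of_ne_zero hp2) (by simpa using this)
    rw [hidx]
  · -- saturation: `x ∈ O₍ₚ₎`, `y ∈ π O₍ₚ₎`, `x - y ∈ p O₍ₚ₎ ⊆ π O₍ₚ₎` ⇒ `x ∈ π O₍ₚ₎`
    have h := Submodule.add_mem _ (hKπ hxy) hy
    rwa [sub_add_cancel] at h

/-! ### The norm-level complement `Y_R = π^R O₍ₚ₎` -/

/-- **The complement of the norm levels `X_k`, `k < R`, in the ramified local order is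
`π^R O₍ₚ₎`** (every non-zero element of `O₍ₚ₎` is a unit of `B` of some norm valuation
`k ≥ 0`, lying in `X_k`). [cite: VignerasLNM800, Ch. II §1 Lemme 1.4] -/
theorem diff_iUnion_normLevelUnits_eq_of_ramified (R : ℕ) (π : Bˣ)
    (hπ : padicValRat p (reducedNorm ℚ B (π : B)) = 1) :
    (localAt p O : Set B) \ ⋃ k ∈ Finset.range R, Units.val '' normLevelUnits p O k =
      (((π ^ R) • localAt p O : Submodule ℤ B) : Set B) := by
  haveI : Nontrivial B := IsQuaternionAlgebra.nontrivial_rat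
  have hπR : padicValRat p (reducedNorm ℚ B ((π ^ R : Bˣ) : B)) = R := by
    rw [padicValRat_reducedNorm_units_pow, hπ, mul_one]
  ext x
  simp only [Set.mem_sdiff, SetLike.mem_coe, Set.mem_iUnion, Set.mem_image, Finset.mem_range,
    not_exists, not_and]
  rw [mem_units_smul_localAt_iff_of_ramified hdiv hΛ, hπR]
  constructor
  · rintro ⟨hx, hnot⟩
    by_cases hx0 : x = 0
    · exact Or.inl hx0
    right
    set u := (hdiv x hx0).unit with hu
    have huv : (u : B) = x := IsUnit.unit_spec _
    have huΛ : (u : B) ∈ localAt p O := by rwa [huv]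
    obtain ⟨k, hk⟩ := hO.exists_mem_normLevelUnits huΛ
    have hvk := hO.padicValRat_reducedNorm_of_mem_normLevelUnits hk
    rw [huv] at hvk
    rw [hvk]
    by_contra hlt
    push Not at hlt
    have hkR : k < R := by exact_mod_cast hlt
    exact hnot k hkR u hk huv
  · rintro h
    have hxΛ : x ∈ localAt p O := by
      rcases h with rfl | h
      · exact Submodule.zero_mem _
      · by_cases hx0 : x = 0
        · rw [hx0]; exact Submodule.zero_mem _
        exact (mem_localAt_iff_padicValRat_of_ramified hΛ _).mpr
          (le_trans (by exact_mod_cast Nat.zero_le R) h)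
    refine ⟨hxΛ, fun k hk u hu hux => ?_⟩
    have hvk := hO.padicValRat_reducedNorm_of_mem_normLevelUnits hu
    rw [hux] at hvk
    rcases h with rfl | h
    · exact u.ne_zero hux
    · rw [hvk] at h
      have : (R : ℤ) ≤ k := by exact_mod_cast h
      omega

/-- **The norm-level complement has `p^{2R}` residues modulo `p^R O₍ₚ₎`** at a ramified prime:
`|π^R O₍ₚ₎ / p^R O₍ₚ₎| = [O₍ₚ₎ : p^R O₍ₚ₎] / [O₍ₚ₎ : π^R O₍ₚ₎] = p^{4R} / p^{2R}`. This is the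
`Y_R`-term of `IsZOrder.pow_eq_sum_ncard_image_normLevel_add`. [cite: VignerasLNM800, Ch. II §1 Lemme 1.4 and Cor. 1.7] -/
theorem ncard_image_normLevel_compl_of_ramified (R : ℕ) :
    (QuotientAddGroup.mk '' ((localAt p O : Set B) \ ⋃ k ∈ Finset.range R,
        Units.val '' normLevelUnits p O k) :
      Set (B ⧸ (((p : ℤ) ^ R) • localAt p O).toAddSubgroup)).ncard = p ^ (2 * R) := by
  classical
  obtain ⟨π, -, hπ⟩ := exists_uniformizer_of_ramified hdiv hO hΛ
  haveI : Nontrivial B := IsQuaternionAlgebra.nontrivial_rat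
  have hπR : padicValRat p (reducedNorm ℚ B ((π ^ R : Bˣ) : B)) = R := by
    rw [padicValRat_reducedNorm_units_pow, hπ, mul_one]
  set K : Submodule ℤ B := ((p : ℤ) ^ R) • localAt p O with hK
  have hKπ : K ≤ (π ^ R) • localAt p O :=
    pow_smul_localAt_le_units_smul_of_ramified hdiv hΛ (π ^ R) R (by rw [hπR])
  have hπΛ : (π ^ R) • localAt p O ≤ localAt p O := by
    intro x hx
    rw [mem_units_smul_localAt_iff_of_ramified hdiv hΛ, hπR] at hx
    rcases hx with rfl | hx
    · exact Submodule.zero_mem _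
    · by_cases hx0 : x = 0
      · rw [hx0]; exact Submodule.zero_mem _
      · exact (mem_localAt_iff_padicValRat_of_ramified hΛ _).mpr
          (le_trans (by exact_mod_cast Nat.zero_le R) hx)
  rw [diff_iUnion_normLevelUnits_eq_of_ramified hdiv hO hΛ R π hπ,
    show (((π ^ R) • localAt p O : Submodule ℤ B) : Set B) = (((π ^ R) • localAt p O).toAddSubgroup : Set B) from rfl,
    ncard_image_mk_eq_relIndex]
  have hmul := AddSubgroup.relIndex_mul_relIndex (H := K.toAddSubgroup)
    (K := ((π ^ R) • localAt p O).toAddSubgroup) (L := (localAt p O).toAddSubgroup)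
    (Submodule.toAddSubgroup_mono hKπ) (Submodule.toAddSubgroup_mono hπΛ)
  rw [relIndex_units_smul_localAt_of_ramified hO hΛ (π ^ R) R hπR, hK,
    relIndex_pow_smul_localAt hO R] at hmul
  have hp2 : p ^ (2 * R) ≠ 0 := pow_ne_zero _ hp.out.ne_zero
  have : K.toAddSubgroup.relIndex ((π ^ R) • localAt p O).toAddSubgroup * p ^ (2 * R) =
      p ^ (2 * R) * p ^ (2 * R) := by
    rw [hmul]; ring
  exact Nat.eq_of_mul_eq_mul_right (pos_of_ne_zero hp2) this

end Ramified

end Literature.NumberTheory.Automorphic
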